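import Literature.NumberTheory.Sieve.SieveFrameworkFundamentalLemma
import HarnessLib

/-!
# Matomäki–Merikoski, Lemma 3.2 (i): the pointwise `β`-sieve expansion of `1_{(n, P(z)) = 1}`

Sibling of `Literature/Barriers/Parity/SiegelZeroPrimePairs.lean` (the catalogue entry vendoring
Matomäki–Merikoski, *Siegel zeros, twin primes, Goldbach's conjecture, and primes in short
intervals* (IMRN 2023; arXiv:2112.11412), Theorem 1.3 as the named fact
`Literature.Barriers.Parity.MatomakiMerikoski2023_pairCorrelation`). §3.2 of the source ("Sieves")
supplies the sieve input of Proposition 2.3, Lemma 3.3 and Lemma 2.4 (§§5–6): Lemma 3.2, "a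
technical version of the fundamental lemma of the sieve" for the upper-bound `β`-sieve weights
`λ_d = μ(d) 1_{d ∈ 𝒟}`, `𝒟 = {d = p₁ ⋯ p_r ∣ P(z) : p₁ > ⋯ > p_r, p₁ ⋯ p_m p_m^β < D for all odd m}`.
This `𝒟` is exactly Rosser's truncation set of the tree's beta-sieve development
(`Literature.NumberTheory.Sieve.BetaSieve.pred 1 β D`, file `SieveFrameworkFundamentalLemma.lean`,
after Greaves, *Sieves in Number Theory*, §3.3.1), so `λ_d = μ(d) · BetaSieve.ind 1 β D d`, and this
file PROVES part (i) of the lemma from that development (theorems only; no definition and no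
named fact is introduced):

* `MatomakiMerikoski.sum_moebius_ind_dvd_eq`, `MatomakiMerikoski.indicator_coprime_eq_sum_sub_bdrySum`
  — the EXACT identity behind (i): for squarefree `P` and `n ≥ 1`,
  `1_{(n, P) = 1} = ∑_{d ∣ (n, P)} λ_d − E(n)`, `E(n) = ∑_{t ∣ P, t ∣ n} χ̄⁺(t) 1_{(n, P_{<q(t)}) = 1} ≥ 0`
  (`χ̄⁺` the boundary indicator `BetaSieve.bdry 1 β D`, `q(t)` the least prime factor of `t`;
  this is the source's "`= ∑_{d ∣ (n,P(z))} λ_d − ∑_{r odd} S_r(n)`"), obtained from the tree's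
  main-term identity `BetaSieve.mainTerm_identity` (Greaves (3.1.2.15)–(3.1.2.16)) applied to the
  multiplicative function `1_{· ∣ n}`;
* `MatomakiMerikoski.bdrySum_le` — the bound for `E(n)`: every boundary `t` has
  `ν(t) + β > log D/log z` and `q(t) ≥ z^{(1−1/β)^{ν(t)}}` (the tree's `BetaSieve.bdry_props`,
  Greaves §3.3.3 Lemma 4 and §3.3.4 Lemma 5 (ii) = the source's "non-empty only if `r ≥ uθ − β`"
  and "`p_r ≥ z_r` (see e.g. [IwKo])"), and the `t` of index `r` dividing `n` number at most
  `τ(n) ≤ 2^{−Ar} τ(n)^{A+1}`;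
* `MatomakiMerikoski2023_lemma32_i` — **Lemma 3.2 (i)** in the source's parametrisation
  `D = X^θ`, `z = X^{1/u}`, `z_r = z^{((β−1)/β)^r}`:
  `|1_{(n, P) = 1} − ∑_{d ∣ (n, P)} λ_d| ≤ ∑_{0 ≤ r ≤ n, r ≥ uθ − β} 2^{−Ar} τ(n)^{A+1} 1_{(n, P_{<z_r}) = 1}`
  for every squarefree `P` with prime factors `< z` (this covers `P(z)` and all the `P_v(z)`,
  `v ≥ 1`, of the source at once), every `A ∈ ℕ`, `β > 1`, `uθ ≥ β`, `X > 1`, with implied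
  constant `1`;
* `MatomakiMerikoski.abs_moebius_mul_ind_le_one`, `MatomakiMerikoski.ind_eq_zero_of_level_le` —
  "`|λ_d| ≤ 1` supported on `d ≤ D`" (the tree's `BetaSieve.abs_ind_le_one`, `BetaSieve.lt_level_of_pred`).

NOT here: part (ii) of Lemma 3.2 (the main term `∑_{d ∣ P(z)} λ_d g(d) = (1 + O(e^{−Aθu/2})) ∏_{p<z}(1 − g(p))`
for multiplicative `g` with `|g(p)| ≤ 2/p`, which is where "`β` sufficiently large in terms of `A`"
enters) and Lemma 3.3.

## References

* K. Matomäki, J. Merikoski, *Siegel zeros, twin primes, Goldbach's conjecture, and primes in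
  short intervals*, IMRN 2023:23, 20337–20384 (arXiv:2112.11412): §3.2, Lemma 3.2 and its proof
  (read in the held text, `lit read arxiv:2112.11412`, chunks p0010–p0011).
  [cite: MatomakiMerikoski2023, Lemma 3.2 (i)]
* G. Greaves, *Sieves in Number Theory*, Springer 2001, §3.1.2 ((2.12)–(2.16)), §3.3.1 ((1.1)),
  §3.3.3 (Lemmas 2–4), §3.3.4 (Lemma 5) (the tree's `SieveFrameworkFundamentalLemma.lean`).
  [cite: Greaves2001, §3.3]
* J. Friedlander, H. Iwaniec, *Opera de Cribro*, AMS Colloquium Publ. 57 (2010), §6.5 (the beta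
  sieve; the source's reference [Opera]). [cite: FriedlanderIwaniecOpera2010, §6.5]
-/

noncomputable section

open Finset
open scoped ArithmeticFunction.Moebius

namespace Literature.Barriers.Parity.MatomakiMerikoski

open Literature.NumberTheory.Sieve Literature.NumberTheory.Sieve.BetaSieve

variable {par : ℕ} {β D : ℝ}

/-! ### The boundary of Rosser's truncation sets -/

/-- `χ̄(t) ∈ {0, 1}`: if `χ̄(t) ≠ 0` then `χ̄(t) = 1`. [folklore] -/
theorem bdry_eq_one_of_ne_zero {t : ℕ} (h : bdry par β D t ≠ 0) : bdry par β D t = 1 := by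
  unfold bdry at h ⊢
  split_ifs at h ⊢ with hc
  · rfl
  · exact absurd rfl h

/-- On the boundary (`χ̄(t) ≠ 0`) the index `ν(t)` has the parity `par`, `t / q(t)` lies in the
truncation set and `t` does not. [cite: Greaves2001, §3.1.2 (2.12)–(2.13)] -/
theorem bdry_ne_zero_props {t : ℕ} (h : bdry par β D t ≠ 0) :
    t.primeFactors.card % 2 = par % 2 ∧ pred par β D (t / t.minFac) ∧ ¬ pred par β D t := by
  unfold bdry at h
  split_ifs at h with hc
  · obtain ⟨h1, h2⟩ := hc
    have ht1 : 1 < t := by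
      by_contra hle
      exact h2 (pred_of_le_one (not_lt.mp hle))
    refine ⟨?_, h1, h2⟩
    by_contra hpar
    exact h2 ((pred_iff ht1).mpr ⟨h1, fun h' => absurd h' hpar⟩)
  · exact absurd rfl h

/-- For the upper sieve (`par = 1`) the boundary terms have odd index, so `μ(t) χ̄⁺(t) = −χ̄⁺(t)`
for squarefree `t`. [cite: MatomakiMerikoski2023, §3.2 (proof of Lemma 3.2: "`∑_{r odd} S_r(n)`")] -/
theorem moebius_mul_bdry_one {t : ℕ} (ht : Squarefree t) :
    (μ t : ℝ) * bdry 1 β D t = -bdry 1 β D t := by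
  by_cases h : bdry 1 β D t = 0
  · rw [h, mul_zero, neg_zero]
  · obtain ⟨hpar, -, -⟩ := bdry_ne_zero_props h
    have hodd : Odd t.primeFactors.card := Nat.odd_iff.mpr (by omega)
    rw [moebius_of_squarefree ht, hodd.neg_one_pow, neg_one_mul]

/-! ### The exact pointwise identity -/

/-- `(n, P) = 1` iff no prime factor of `P` divides `n` (`P ≠ 0`). [folklore] -/
theorem coprime_iff_forall_primeFactors {n P : ℕ} (hP : P ≠ 0) :
    n.Coprime P ↔ ∀ p ∈ P.primeFactors, ¬ p ∣ n := by
  constructor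
  · intro h p hp hpn
    have hp' := Nat.prime_of_mem_primeFactors hp
    exact hp'.one_lt.ne' (Nat.eq_one_of_dvd_coprimes h hpn (Nat.dvd_of_mem_primeFactors hp))
  · intro h
    refine Nat.coprime_of_dvd fun k hk hkn hkP => ?_
    exact h k (Nat.mem_primeFactors.mpr ⟨hk, hkP, hP⟩) hkn

/-- A product of `0/1` factors: `∏_{i ∈ s} (1 − 1_{q i}) = 1_{∀ i ∈ s, ¬ q i}`. [folklore] -/
theorem prod_one_sub_boole {ι : Type*} (s : Finset ι) (q : ι → Prop) [DecidablePred q] :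
    ∏ i ∈ s, (1 - (if q i then (1 : ℝ) else 0)) = if ∀ i ∈ s, ¬ q i then 1 else 0 := by
  rw [← Finset.prod_boole]
  refine Finset.prod_congr rfl fun i _ => ?_
  split_ifs <;> norm_num

/-- **The Legendre–Buchstab expansion of `1_{(n, P) = 1}` along Rosser's truncation sets, exactly**
(the identity behind "`1_{(n, P(z)) = 1} = ∑_{d ∣ (n, P(z))} λ_d − ∑_{r odd} S_r(n)`" in the proof
of Lemma 3.2, for either parity `par` and any squarefree `P`): with `χ = BetaSieve.ind par β D`
and its boundary `χ̄ = BetaSieve.bdry par β D`,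
`∑_{d ∣ (n, P)} μ(d) χ(d) = 1_{(n, P) = 1} − ∑_{t ∣ P, t ∣ n} μ(t) χ̄(t) 1_{(n, P_{<q(t)}) = 1}`,
where `P_{<q} = ∏_{p ∣ P, p < q} p` and `q(t)` is the least prime factor of `t`. It is the tree's
main-term identity `BetaSieve.mainTerm_identity` (Greaves (3.1.2.15)–(3.1.2.16)) for the
multiplicative function `g = 1_{· ∣ n}`. [cite: MatomakiMerikoski2023, Lemma 3.2 (i) (proof)] -/
theorem sum_moebius_ind_dvd_eq {P : ℕ} (hP : Squarefree P) {n : ℕ} (hn : n ≠ 0) (par : ℕ)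
    (β D : ℝ) :
    ∑ d ∈ P.divisors, (if d ∣ n then (μ d : ℝ) * ind par β D d else 0) =
      (if n.Coprime P then (1 : ℝ) else 0) -
        ∑ t ∈ P.divisors, (μ t : ℝ) * bdry par β D t *
          (if t ∣ n ∧ (∀ p ∈ P.primeFactors, p < t.minFac → ¬ p ∣ n) then 1 else 0) := by
  classical
  -- the divisibility indicator of `n` as a multiplicative arithmetic function
  let g : ArithmeticFunction ℝ := ⟨fun d => if d ∣ n then 1 else 0, by simp [hn]⟩
  have hg_apply : ∀ d, g d = if d ∣ n then 1 else 0 := fun d => rfl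
  have hgm : g.IsMultiplicative := by
    refine ⟨by simp [hg_apply], fun {a b} hab => ?_⟩
    simp only [hg_apply]
    by_cases ha : a ∣ n
    · by_cases hb : b ∣ n
      · rw [if_pos (hab.mul_dvd_of_dvd_of_dvd ha hb), if_pos ha, if_pos hb, mul_one]
      · rw [if_neg (fun h => hb ((Dvd.intro_left _ rfl).trans h)), if_neg hb, mul_zero]
    · rw [if_neg (fun h => ha ((Dvd.intro _ rfl).trans h)), if_neg ha, zero_mul]
  have hmain := mainTerm_identity (par := par) (β := β) (D := D) hgm hP
  -- identify the four pieces
  have hlhs : ∑ d ∈ P.divisors, (μ d : ℝ) * ind par β D d * g d =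
      ∑ d ∈ P.divisors, (if d ∣ n then (μ d : ℝ) * ind par β D d else 0) := by
    refine Finset.sum_congr rfl fun d _ => ?_
    rw [hg_apply]; split_ifs <;> simp
  have hV : vprod g P = if n.Coprime P then (1 : ℝ) else 0 := by
    rw [vprod]
    simp_rw [hg_apply]
    rw [prod_one_sub_boole]
    exact if_congr (coprime_iff_forall_primeFactors hP.ne_zero).symm rfl rfl
  have hVlt : ∀ t : ℕ, vlt g P t.minFac =
      if ∀ p ∈ P.primeFactors, p < t.minFac → ¬ p ∣ n then (1 : ℝ) else 0 := by
    intro t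
    rw [vlt]
    simp_rw [hg_apply]
    rw [prod_one_sub_boole]
    simp only [Finset.mem_filter, and_imp]
  have hrhs : ∑ t ∈ P.divisors, (μ t : ℝ) * bdry par β D t * g t * vlt g P t.minFac =
      ∑ t ∈ P.divisors, (μ t : ℝ) * bdry par β D t *
        (if t ∣ n ∧ (∀ p ∈ P.primeFactors, p < t.minFac → ¬ p ∣ n) then 1 else 0) := by
    refine Finset.sum_congr rfl fun t _ => ?_
    rw [hVlt t, hg_apply, mul_assoc]
    congr 1
    by_cases h1 : t ∣ n
    · by_cases h2 : ∀ p ∈ P.primeFactors, p < t.minFac → ¬ p ∣ n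
      · rw [if_pos h1, if_pos h2, if_pos ⟨h1, h2⟩, one_mul]
      · rw [if_neg h2, mul_zero,
          if_neg (show ¬ (t ∣ n ∧ ∀ p ∈ P.primeFactors, p < t.minFac → ¬ p ∣ n) from
            fun h => h2 h.2)]
    · rw [if_neg h1, zero_mul,
        if_neg (show ¬ (t ∣ n ∧ ∀ p ∈ P.primeFactors, p < t.minFac → ¬ p ∣ n) from
          fun h => h1 h.1)]
  rw [← hlhs, hmain, hV, hrhs]

/-- **Lemma 3.2 (i), exact form for the upper sieve**: for squarefree `P` and `n ≥ 1`,
`1_{(n, P) = 1} = ∑_{d ∣ (n, P)} λ_d − E(n)` with `λ_d = μ(d) χ⁺(d)` (Rosser's upper `β`-sieve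
weights, `χ⁺ = BetaSieve.ind 1 β D`) and the NON-NEGATIVE boundary sum
`E(n) = ∑_{t ∣ P, t ∣ n} χ̄⁺(t) 1_{(n, P_{<q(t)}) = 1}` ("`= ∑_{d ∣ (n,P(z))} λ_d − ∑_{r odd} S_r(n)`").
[cite: MatomakiMerikoski2023, Lemma 3.2 (i) (proof)] -/
theorem indicator_coprime_eq_sum_sub_bdrySum {P : ℕ} (hP : Squarefree P) {n : ℕ} (hn : n ≠ 0)
    (β D : ℝ) :
    (if n.Coprime P then (1 : ℝ) else 0) =
      ∑ d ∈ P.divisors, (if d ∣ n then (μ d : ℝ) * ind 1 β D d else 0) -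
        ∑ t ∈ P.divisors, bdry 1 β D t *
          (if t ∣ n ∧ (∀ p ∈ P.primeFactors, p < t.minFac → ¬ p ∣ n) then 1 else 0) := by
  rw [sum_moebius_ind_dvd_eq hP hn 1 β D]
  have h : ∑ t ∈ P.divisors, (μ t : ℝ) * bdry 1 β D t *
      (if t ∣ n ∧ (∀ p ∈ P.primeFactors, p < t.minFac → ¬ p ∣ n) then (1 : ℝ) else 0) =
      -∑ t ∈ P.divisors, bdry 1 β D t *
        (if t ∣ n ∧ (∀ p ∈ P.primeFactors, p < t.minFac → ¬ p ∣ n) then (1 : ℝ) else 0) := by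
    rw [← Finset.sum_neg_distrib]
    refine Finset.sum_congr rfl fun t ht => ?_
    rw [moebius_mul_bdry_one (hP.squarefree_of_dvd (Nat.dvd_of_mem_divisors ht))]
    ring
  rw [h]
  ring

/-- The boundary sum `E(n)` is non-negative (so `1_{(n,P)=1} ≤ ∑_{d ∣ (n,P)} λ_d`: the upper-sieve
inequality). [cite: MatomakiMerikoski2023, Lemma 3.2 (i) (proof)] -/
theorem bdrySum_nonneg (P n : ℕ) (β D : ℝ) :
    0 ≤ ∑ t ∈ P.divisors, bdry 1 β D t *
      (if t ∣ n ∧ (∀ p ∈ P.primeFactors, p < t.minFac → ¬ p ∣ n) then (1 : ℝ) else 0) :=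
  Finset.sum_nonneg fun t _ => mul_nonneg (bdry_nonneg t) (by split_ifs <;> norm_num)

/-! ### The size of the boundary sum: Lemma 3.2 (i) -/

/-- `τ(t) = 2^{ω(t)}` for squarefree `t`; a private copy of
`Literature.NumberTheory.Sieve.card_divisors_of_squarefree` (`AsymptoticSieveForPrimesReduction.lean`,
not imported here to keep the import closure small). [folklore] -/
private theorem card_divisors_of_squarefree {t : ℕ} (ht : Squarefree t) :
    t.divisors.card = 2 ^ t.primeFactors.card := by
  rw [Nat.card_divisors ht.ne_zero, ← Finset.prod_const]
  refine Finset.prod_congr rfl fun p hp => ?_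
  have h1 : t.factorization p ≤ 1 := Squarefree.natFactorization_le_one p ht
  have h2 : 0 < t.factorization p :=
    (Nat.prime_of_mem_primeFactors hp).factorization_pos_of_dvd ht.ne_zero
      (Nat.dvd_of_mem_primeFactors hp)
  omega

/-- If a squarefree `t` with `r` prime factors divides `n ≠ 0`, then `2^r ≤ τ(n)`. [folklore] -/
theorem two_pow_le_card_divisors {t n : ℕ} (hn : n ≠ 0) (ht : Squarefree t) (htn : t ∣ n) :
    2 ^ t.primeFactors.card ≤ n.divisors.card := by
  rw [← card_divisors_of_squarefree ht]
  exact Finset.card_le_card (Nat.divisors_subset_of_dvd hn htn)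

/-- `ω(t) ≤ t` (crudely: the prime factors of `t ≠ 0` are divisors, and `τ(t) ≤ t`). [folklore] -/
theorem card_primeFactors_le_self (t : ℕ) : t.primeFactors.card ≤ t := by
  rcases Nat.eq_zero_or_pos t with rfl | ht
  · simp
  · calc t.primeFactors.card ≤ t.divisors.card := by
          refine Finset.card_le_card fun p hp => ?_
          exact Nat.mem_divisors.mpr ⟨Nat.dvd_of_mem_primeFactors hp, ht.ne'⟩
      _ ≤ t := Nat.card_divisors_le_self t

/-- **Matomäki–Merikoski 2023, Lemma 3.2 (i): the bound for the boundary sum** ("Since `p_j < z`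
and `p₁ p₂ ⋯ p_r p_r^β ≥ D`, the sum in `S_r(n)` is non-empty only if `r ≥ uθ − β`. Furthermore …
`p_r ≥ z_r` … Hence `S_r(n) ≤ ∑_{n = mk, p ∣ mk ⇒ p ≥ z_r} 2^{Aω(m) − Ar} ≤ 2^{−Ar} τ(n)^{A+1} 1_{(n, P(z_r)) = 1}`"):
for squarefree `P` with all prime factors `< z`, `1 < z`, `1 < β`, `1 < D`, `z^β ≤ D`
(`s = log D/log z ≥ β`), `n ≥ 1` and any `A ∈ ℕ`, the boundary sum of
`indicator_coprime_eq_sum_sub_bdrySum` satisfies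
`E(n) ≤ ∑_{r : log D < (r + β) log z} τ(n)^{A+1} 2^{−Ar} 1_{(n, P_{<z_r}) = 1}`, `z_r = z^{(1 − 1/β)^r}`
(`r` ranges over `[0, n]`, which contains every index that occurs). The two facts about boundary
terms are the tree's `BetaSieve.bdry_props` (Greaves §3.3.3 Lemma 4, §3.3.4 Lemma 5 (ii)).
[cite: MatomakiMerikoski2023, Lemma 3.2 (i)] -/
theorem bdrySum_le {P : ℕ} (hP : Squarefree P) {z β D : ℝ} (hβ : 1 < β) (hz : 1 < z) (hD1 : 1 < D)
    (hzD : β * Real.log z ≤ Real.log D) (hPz : ∀ p ∈ P.primeFactors, (p : ℝ) < z) {n : ℕ}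
    (hn : n ≠ 0) (A : ℕ) :
    ∑ t ∈ P.divisors, bdry 1 β D t *
        (if t ∣ n ∧ (∀ p ∈ P.primeFactors, p < t.minFac → ¬ p ∣ n) then (1 : ℝ) else 0) ≤
      ∑ r ∈ (Finset.range (n + 1)).filter (fun r : ℕ => Real.log D < ((r : ℝ) + β) * Real.log z),
        (n.divisors.card : ℝ) ^ (A + 1) / (2 : ℝ) ^ (A * r) *
          (if ∀ p ∈ P.primeFactors, (p : ℝ) < z ^ ((1 - 1 / β) ^ r) → ¬ p ∣ n then 1 else 0) := by
  classical
  have hz0 : 0 < z := by linarith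
  -- the boundary sum counts the set `T`
  set T := P.divisors.filter (fun t => bdry 1 β D t ≠ 0 ∧ t ∣ n ∧
    (∀ p ∈ P.primeFactors, p < t.minFac → ¬ p ∣ n)) with hT
  have hE : ∑ t ∈ P.divisors, bdry 1 β D t *
      (if t ∣ n ∧ (∀ p ∈ P.primeFactors, p < t.minFac → ¬ p ∣ n) then (1 : ℝ) else 0) =
      (T.card : ℝ) := by
    rw [hT, Finset.natCast_card_filter]
    refine Finset.sum_congr rfl fun t _ => ?_
    by_cases hb : bdry 1 β D t = 0
    · rw [hb, zero_mul, if_neg (fun h => h.1 rfl)]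
    · rw [bdry_eq_one_of_ne_zero hb, one_mul]
      by_cases hc : t ∣ n ∧ (∀ p ∈ P.primeFactors, p < t.minFac → ¬ p ∣ n)
      · rw [if_pos hc, if_pos ⟨one_ne_zero, hc⟩]
      · rw [if_neg hc, if_neg (fun h => hc h.2)]
  -- what the boundary lemmas say about an element of `T`
  have hTprops : ∀ t ∈ T, t ∣ n ∧ Squarefree t ∧
      Real.log D < (t.primeFactors.card + β) * Real.log z ∧
      (∀ p ∈ P.primeFactors, (p : ℝ) < z ^ ((1 - 1 / β) ^ t.primeFactors.card) → ¬ p ∣ n) := by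
    intro t ht
    rw [hT, Finset.mem_filter] at ht
    obtain ⟨htP, hb, htn, hcond⟩ := ht
    have htP' := Nat.dvd_of_mem_divisors htP
    have hsq : Squarefree t := hP.squarefree_of_dvd htP'
    have hpz : ∀ p ∈ t.primeFactors, (p : ℝ) < z := fun p hp =>
      hPz p (Nat.primeFactors_mono htP' hP.ne_zero hp)
    obtain ⟨-, h', h⟩ := bdry_ne_zero_props hb
    obtain ⟨hlogq, hidx⟩ := bdry_props (par := 1) hβ hz hD1 hzD hsq hpz h' h
    refine ⟨htn, hsq, hidx, fun p hp hpzr => hcond p hp ?_⟩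
    have ht1 : t ≠ 1 := fun h1 => h (pred_of_le_one h1.le)
    have hq := Nat.minFac_prime ht1
    have hq0 : (0 : ℝ) < t.minFac := by exact_mod_cast hq.pos
    have hle : z ^ ((1 - 1 / β) ^ t.primeFactors.card) ≤ (t.minFac : ℝ) := by
      rw [Real.rpow_def_of_pos hz0, ← Real.exp_log hq0]
      exact Real.exp_le_exp.mpr (by rw [mul_comm]; exact hlogq)
    exact_mod_cast lt_of_lt_of_le hpzr hle
  -- fibres over the index `r = ω(t)`
  have hmaps : ∀ t ∈ T, t.primeFactors.card ∈ Finset.range (n + 1) := by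
    intro t ht
    obtain ⟨htn, -, -, -⟩ := hTprops t ht
    rw [Finset.mem_range]
    exact lt_of_le_of_lt ((card_primeFactors_le_self t).trans (Nat.le_of_dvd (Nat.pos_of_ne_zero hn) htn))
      (Nat.lt_succ_self n)
  have hcardT : (T.card : ℝ) = ∑ r ∈ Finset.range (n + 1),
      ((T.filter (fun t => t.primeFactors.card = r)).card : ℝ) := by
    exact_mod_cast Finset.card_eq_sum_card_fiberwise hmaps
  have hτ0 : (0 : ℝ) < n.divisors.card := by
    exact_mod_cast Finset.card_pos.mpr ⟨1, Nat.one_mem_divisors.mpr hn⟩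
  have hfiber : ∀ r ∈ Finset.range (n + 1),
      ((T.filter (fun t => t.primeFactors.card = r)).card : ℝ) ≤
        if Real.log D < ((r : ℝ) + β) * Real.log z then
          (n.divisors.card : ℝ) ^ (A + 1) / (2 : ℝ) ^ (A * r) *
            (if ∀ p ∈ P.primeFactors, (p : ℝ) < z ^ ((1 - 1 / β) ^ r) → ¬ p ∣ n then 1 else 0)
        else 0 := by
    intro r _
    by_cases hemp : T.filter (fun t => t.primeFactors.card = r) = ∅
    · rw [hemp, Finset.card_empty, Nat.cast_zero]
      split_ifs <;> positivity
    · obtain ⟨t₀, ht₀⟩ := Finset.nonempty_iff_ne_empty.mpr hemp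
      rw [Finset.mem_filter] at ht₀
      obtain ⟨ht₀T, ht₀r⟩ := ht₀
      obtain ⟨ht₀n, ht₀sq, hidx, hcond⟩ := hTprops t₀ ht₀T
      rw [ht₀r] at hidx hcond
      rw [if_pos hidx, if_pos hcond, mul_one]
      have h1 : (T.filter (fun t => t.primeFactors.card = r)).card ≤ n.divisors.card := by
        refine Finset.card_le_card fun t ht => ?_
        obtain ⟨htn, -, -, -⟩ := hTprops t (Finset.mem_filter.mp ht).1
        exact Nat.mem_divisors.mpr ⟨htn, hn⟩
      have h2 : (2 : ℝ) ^ r ≤ n.divisors.card := by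
        have := two_pow_le_card_divisors hn ht₀sq ht₀n
        rw [ht₀r] at this
        exact_mod_cast this
      have h3 : (1 : ℝ) ≤ (n.divisors.card : ℝ) / 2 ^ r := by
        rwa [le_div_iff₀ (by positivity), one_mul]
      calc ((T.filter (fun t => t.primeFactors.card = r)).card : ℝ) ≤ n.divisors.card := by
            exact_mod_cast h1
        _ = n.divisors.card * 1 := (mul_one _).symm
        _ ≤ n.divisors.card * ((n.divisors.card : ℝ) / 2 ^ r) ^ A :=
            mul_le_mul_of_nonneg_left (one_le_pow₀ h3) hτ0.le
        _ = (n.divisors.card : ℝ) ^ (A + 1) / (2 : ℝ) ^ (A * r) := by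
            rw [div_pow, ← pow_mul, pow_succ, mul_comm r A]; ring
  calc ∑ t ∈ P.divisors, bdry 1 β D t *
        (if t ∣ n ∧ (∀ p ∈ P.primeFactors, p < t.minFac → ¬ p ∣ n) then (1 : ℝ) else 0)
      = (T.card : ℝ) := hE
    _ = ∑ r ∈ Finset.range (n + 1), ((T.filter (fun t => t.primeFactors.card = r)).card : ℝ) :=
        hcardT
    _ ≤ ∑ r ∈ Finset.range (n + 1),
          (if Real.log D < ((r : ℝ) + β) * Real.log z then
            (n.divisors.card : ℝ) ^ (A + 1) / (2 : ℝ) ^ (A * r) *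
              (if ∀ p ∈ P.primeFactors, (p : ℝ) < z ^ ((1 - 1 / β) ^ r) → ¬ p ∣ n then 1 else 0)
          else 0) := Finset.sum_le_sum hfiber
    _ = _ := by rw [Finset.sum_filter]

/-! ### The weights `λ_d = μ(d) χ⁺(d)`: size and support -/

/-- `|λ_d| ≤ 1`. [cite: MatomakiMerikoski2023, Lemma 3.2 ("coefficients `λ_d` with `|λ_d| ≤ 1`")] -/
theorem abs_moebius_mul_ind_le_one (par : ℕ) (β D : ℝ) (d : ℕ) :
    |(μ d : ℝ) * ind par β D d| ≤ 1 := by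
  rw [abs_mul]
  have hμ : |(μ d : ℝ)| ≤ 1 := by exact_mod_cast ArithmeticFunction.abs_moebius_le_one
  exact mul_le_one₀ hμ (abs_nonneg _) (abs_ind_le_one d)

/-- `λ_d` is supported on `d < D`: for squarefree `d` with all prime factors `< z ≤ D^{1/β}`,
`χ(d) = 0` unless `d < D` (the tree's `BetaSieve.lt_level_of_pred`).
[cite: MatomakiMerikoski2023, Lemma 3.2 ("supported on `d ≤ D`")] -/
theorem ind_eq_zero_of_level_le {par : ℕ} {z β D : ℝ} (hβ : 1 < β) (hD1 : 1 < D)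
    (hzD : β * Real.log z ≤ Real.log D) {d : ℕ} (hd : Squarefree d)
    (hdz : ∀ p ∈ d.primeFactors, (p : ℝ) < z) (hDd : D ≤ (d : ℝ)) : ind par β D d = 0 := by
  by_contra h
  have hpred : pred par β D d := by
    by_contra hp
    exact h (ind_of_not_pred hp)
  exact absurd (lt_level_of_pred hβ hD1 hzD hd hdz hpred) (not_lt.mpr hDd)

end Literature.Barriers.Parity.MatomakiMerikoski

/-! ### Lemma 3.2 (i) in the parametrisation of the source -/

namespace Literature.Barriers.Parity

open Literature.NumberTheory.Sieve Literature.NumberTheory.Sieve.BetaSieve MatomakiMerikoski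

/-- **Matomäki–Merikoski 2023, Lemma 3.2 (i)** (as printed, in the parametrisation of the source):
"Let `θ ∈ (0, 1/3)` and `A ∈ ℕ`. … for any `β ≥ β₀` and `u ≥ β/θ`. Let `X ≥ 2`, write `D = X^θ` and
`z = X^{1/u}`, and define `z_r := z^{((β−1)/β)^r}`. Then there exist coefficients `λ_d` with
`|λ_d| ≤ 1` supported on `d ≤ D` such that … (i) For every `n ∈ ℕ` and any `v ∈ ℕ`,
`1_{(n, P_v(z)) = 1} = ∑_{d ∣ (n, P_v(z))} λ_d + O(∑_{r ≥ uθ − β} 2^{−Ar} 1_{(n, P_v(z_r)) = 1} τ(n)^{A+1})`",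
where `P_v(w) = ∏_{p < w, p ∤ v} p` and the `λ_d = μ(d) 1_{d ∈ 𝒟}` are the upper-bound `β`-sieve
weights, `𝒟 = {d = p₁ ⋯ p_r ∣ P(z) : p₁ > ⋯ > p_r, p₁ ⋯ p_m p_m^β < D for all odd m}` = the tree's
Rosser truncation set `BetaSieve.pred 1 β D` (so `λ_d = μ(d) · BetaSieve.ind 1 β D d`;
`MatomakiMerikoski.abs_moebius_mul_ind_le_one`, `MatomakiMerikoski.ind_eq_zero_of_level_le`).
PROVED with implied constant `1`, for every `A`, `β > 1`, `u, θ > 0` with `uθ ≥ β` and `X > 1`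
(part (i) uses neither `θ < 1/3` nor "`β` large in terms of `A`", which serve part (ii)), and for
an arbitrary squarefree `P` whose prime factors are `< z` in place of `P_v(z)` (covering every
`v` at once; the printed reduction "write `n = n'v'`" is then unnecessary): the exact identity is
`MatomakiMerikoski.indicator_coprime_eq_sum_sub_bdrySum` and the error bound
`MatomakiMerikoski.bdrySum_le`; the index `r` runs over `[0, n] ∩ {r ≥ uθ − β}` and
`1_{(n, P_v(z_r)) = 1}` reads "no prime factor `p < z_r` of `P` divides `n`".
[cite: MatomakiMerikoski2023, Lemma 3.2 (i)] -/
theorem MatomakiMerikoski2023_lemma32_i {X θ u β : ℝ} (A : ℕ) (hX : 1 < X) (hθ : 0 < θ) (hu : 0 < u)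
    (hβ : 1 < β) (hβu : β ≤ u * θ) {P : ℕ} (hP : Squarefree P)
    (hPz : ∀ p ∈ P.primeFactors, (p : ℝ) < X ^ (1 / u)) {n : ℕ} (hn : n ≠ 0) :
    |(if n.Coprime P then (1 : ℝ) else 0) -
        ∑ d ∈ P.divisors, (if d ∣ n then (μ d : ℝ) * ind 1 β (X ^ θ) d else 0)| ≤
      ∑ r ∈ (Finset.range (n + 1)).filter (fun r : ℕ => u * θ - β ≤ (r : ℝ)),
        (n.divisors.card : ℝ) ^ (A + 1) / (2 : ℝ) ^ (A * r) *
          (if ∀ p ∈ P.primeFactors, (p : ℝ) < (X ^ (1 / u)) ^ ((1 - 1 / β) ^ r) → ¬ p ∣ n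
            then 1 else 0) := by
  have hX0 : 0 < X := by linarith
  have hlogX : 0 < Real.log X := Real.log_pos hX
  have hz : 1 < X ^ (1 / u) := Real.one_lt_rpow hX (by positivity)
  have hD1 : 1 < X ^ θ := Real.one_lt_rpow hX hθ
  have hlogz : Real.log (X ^ (1 / u)) = 1 / u * Real.log X := Real.log_rpow hX0 _
  have hlogD : Real.log (X ^ θ) = θ * Real.log X := Real.log_rpow hX0 _
  have hzD : β * Real.log (X ^ (1 / u)) ≤ Real.log (X ^ θ) := by
    rw [hlogz, hlogD]
    have : β * (1 / u) ≤ θ := by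
      rw [mul_one_div, div_le_iff₀ hu]; linarith [mul_comm u θ]
    nlinarith
  rw [indicator_coprime_eq_sum_sub_bdrySum hP hn β (X ^ θ), sub_sub_cancel_left, abs_neg,
    abs_of_nonneg (bdrySum_nonneg P n β (X ^ θ))]
  refine (bdrySum_le hP hβ hz hD1 hzD hPz hn A).trans ?_
  refine Finset.sum_le_sum_of_subset_of_nonneg ?_ fun r _ _ => by positivity
  intro r hr
  rw [Finset.mem_filter] at hr ⊢
  refine ⟨hr.1, ?_⟩
  have h := hr.2
  rw [hlogz, hlogD] at h
  -- `θ log X < (r + β) (log X)/u` gives `uθ < r + β`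
  have h' : θ * u < (r : ℝ) + β := by
    have h1 : θ * Real.log X * u < ((r : ℝ) + β) * Real.log X := by
      calc θ * Real.log X * u = θ * Real.log X / (1 / u) := by field_simp
        _ < ((r : ℝ) + β) * (1 / u * Real.log X) / (1 / u) := by
            apply div_lt_div_of_pos_right h (by positivity)
        _ = ((r : ℝ) + β) * Real.log X := by field_simp
    nlinarith
  linarith [mul_comm u θ]

end Literature.Barriers.Parity
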